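import Summits.ResolutionOfSingularities.ResolutionOfSingularities.Theorems.WeightedInvariantKeyRungThreeOfDropPointTieOff
import HarnessLib

/-!
# (D-b³-point-STAT), ISOLATED regime: the letters `ε` and `τ` of the successor VANISH — hand -11's disprover question, answered in the kernel
# (door `HypersurfaceCentreConstruction`, stmt-ResolutionOfSingularities-19897, stub `stub_keyRungGrHomLE_three`)

Topic: `Summits/ResolutionOfSingularities/ResolutionOfSingularities/Theorems`.  DEF-FREE.  Helper `--supports stmt-ResolutionOfSingularities-19897`.

NONREACH-K.md §4 (hand -11) asked whether an order-stationary `t`-homogeneous successor of an ISOLATED start can have `ε = 1` or `τ = 1`, which would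
raise `ι₀ = (ν ; ε ; τ)` and refute (D-b³-point-STAT) as typed.  With this hand's chain (…IsoSuccNoStatCurve, …KeyRungThreeOfDropPointIso, …IsoSuccDim,
…KeyRungThreeOfDropPointTieOff `pointStat_succ_bookkeeping_of_eps_ne_one`) the answer is a kernel theorem:

* **`Iota3.pointStat_isolated_letters`** — in the binders of (D-b³-point-STAT) with `IsIsolatedPosition S f`, for EVERY presentation of `J₃ᵗ` and
  every order-stationary `t`-homogeneous successor `𝔫`: `ε(B_𝔫, g/1) = 0`, `τ(B_𝔫, g/1) = 0`, and `ι₀(B_𝔫, g/1) = ι₀(S, f)` (`= ω·(ω·ν)`).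

So at isolated starts the stratifier is STATIONARY at every order-stationary successor over the closed point: (D-b³-point-STAT) there neither fails
by an `ι₀`-rise nor succeeds by an `ι₀`-drop — it is decided by `σ` alone (…KeyRungThreeOfDropPointSigma).

[OURS · L1 W4.3 · audit glue; AI work, weaker than expert review; nothing here is a statement of the manuscript under review (Hironaka 2017,
[claim: Hironaka2017, status: under-review]).]
-/

noncomputable section

set_option linter.dupNamespace false -- mandated namespace of this single-conjunct summit

open IsLocalRing Literature.AlgebraicGeometry.Resolution
open Summit.ResolutionOfSingularities.ResolutionOfSingularities.Theorems
open Summit.ResolutionOfSingularities.ResolutionOfSingularities.Theorems.ContactCylinder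

namespace Summit.ResolutionOfSingularities.ResolutionOfSingularities.Cruxes.HypersurfaceCentreConstruction.LocalEngine

namespace Iota3

/-- **At ISOLATED starts `ε` and `τ` do not rise: they vanish at every order-stationary `t`-homogeneous successor, and `ι₀` is stationary.**
[OURS · L1 W4.3 · answer to NONREACH-K §4 in the isolated regime] -/
theorem pointStat_isolated_letters (p : ℕ) (k₀ : Type) [Field k₀] [CharP k₀ p] [PerfectField k₀]
    (S : Type) [CommRing S] [Algebra k₀ S] [Algebra.EssFiniteType k₀ S] [IsRegularLocalRing S]
    (f : S) (hd : ringKrullDim S = 3) (hf0 : f ≠ 0) (hf2 : f ∈ (maximalIdeal S) ^ 2)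
    (P : Ideal S) [P.IsPrime] (hE : topStratum iotaOrdEpsTau S f = {𝔮 | P ≤ 𝔮.asIdeal}) (hPm : P = maximalIdeal S)
    (hiso : IsIsolatedPosition S f)
    (n : ℕ) (u : Fin n → S) (w : Fin n → ℕ) (h1 : Ideal.span (Set.range u) = maximalIdeal S) (h2 : (maximalIdeal S).spanFinrank = n)
    (h5 : ∀ m : ℕ, weightedMonomialIdeal u w m = jFlatT S f m)
    (𝔫 : Ideal (cobordantAlgebra' u w)) [𝔫.IsPrime] (hhom : IsTHomogeneous u w 𝔫) (hT : cobordantT' u w ∈ 𝔫)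
    (hV : ¬ extReesAlgebra.vertexIdeal (weightedMonomialIdeal u w) ≤ 𝔫)
    (a : ℕ) (g : cobordantAlgebra' u w) (hfg : algebraMap S (cobordantAlgebra' u w) f = cobordantT' u w ^ a * g)
    (hTg : ¬ cobordantT' u w ∣ g)
    (ν : ℕ) (hfν : f ∈ maximalIdeal S ^ ν) (hfν1 : f ∉ maximalIdeal S ^ (ν + 1))
    (hgν : algebraMap (cobordantAlgebra' u w) (Localization.AtPrime 𝔫) g ∈ maximalIdeal (Localization.AtPrime 𝔫) ^ ν) :
    iotaEps (Localization.AtPrime 𝔫) (algebraMap (cobordantAlgebra' u w) (Localization.AtPrime 𝔫) g) = 0 ∧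
      iotaTau (Localization.AtPrime 𝔫) (algebraMap (cobordantAlgebra' u w) (Localization.AtPrime 𝔫) g) = 0 ∧
      iotaOrdEpsTau (Localization.AtPrime 𝔫) (algebraMap (cobordantAlgebra' u w) (Localization.AtPrime 𝔫) g) = iotaOrdEpsTau S f := by
  have hε' : iotaEps S f ≠ 1 := by rw [iotaEps_eq_zero_of_isIsolatedPosition hiso]; exact zero_ne_one
  have hν : 0 < ν := by
    by_contra hν0
    have hν0' : ν = 0 := by omega
    subst hν0'
    exact hfν1 (by rw [zero_add, pow_one]; exact Ideal.pow_le_self two_ne_zero hf2)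
  obtain ⟨hreg, hdimB, hgν1⟩ :=
    pointStat_succ_bookkeeping_of_eps_ne_one p k₀ S f hd hf0 hf2 P hE hPm hε' n u w h1 h2 h5 𝔫 hhom hT hV a g hfg hTg ν hfν hfν1
  obtain ⟨hisoB, -⟩ := pointStat_isolated p k₀ S f hd hf0 hf2 P hE hPm hiso n u w h5 𝔫 hhom hT hV a g hfg hTg ν hfν hfν1 hgν
  have hg𝔪 : algebraMap (cobordantAlgebra' u w) (Localization.AtPrime 𝔫) g ∈ maximalIdeal (Localization.AtPrime 𝔫) := by
    have h := Ideal.pow_le_pow_right hν hgν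
    rwa [pow_one] at h
  have hεB : iotaEps (Localization.AtPrime 𝔫) (algebraMap (cobordantAlgebra' u w) (Localization.AtPrime 𝔫) g) = 0 :=
    @iotaEps_eq_zero_of_isIsolatedPosition (Localization.AtPrime 𝔫) _ hreg _ hisoB
  have hτB : iotaTau (Localization.AtPrime 𝔫) (algebraMap (cobordantAlgebra' u w) (Localization.AtPrime 𝔫) g) = 0 :=
    @iotaTau_eq_zero_of_isIsolatedPosition (Localization.AtPrime 𝔫) _ hreg _ hdimB hg𝔪 hisoB
  have hι₀B : iotaOrdEpsTau (Localization.AtPrime 𝔫) (algebraMap (cobordantAlgebra' u w) (Localization.AtPrime 𝔫) g) =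
      Ordinal.omega0 * (Ordinal.omega0 * (ν : Ordinal.{0})) :=
    @iotaOrdEpsTau_eq_of_isIsolatedPosition (Localization.AtPrime 𝔫) _ hreg _ hdimB ν hν hgν hgν1 hisoB
  have hι₀S : iotaOrdEpsTau S f = Ordinal.omega0 * (Ordinal.omega0 * (ν : Ordinal.{0})) :=
    iotaOrdEpsTau_eq_of_isIsolatedPosition (by rw [hd]) hν hfν hfν1 hiso
  exact ⟨hεB, hτB, hι₀B.trans hι₀S.symm⟩

end Iota3

end Summit.ResolutionOfSingularities.ResolutionOfSingularities.Cruxes.HypersurfaceCentreConstruction.LocalEngine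

end
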